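import Literature.Analysis.TotalPositivity.ASWMeromorphic
import Literature.Analysis.TotalPositivity.PolyaFrequencyRecognitionProofs
import HarnessLib

/-!
# Zeros of entire Pólya-frequency generating functions; even subsequences and convolution powers

Trunk T-ANALYSIS (Literature/Analysis/TotalPositivity). Part 6 of the decomposition of the named
fact `Literature.Analysis.TotalPositivity.aswe_edrei` (PolyaFrequency.lean). With Ando's
recognition theorem discharged (`ando1987_lowerTriangular_tn_holds`,
PolyaFrequencyRecognitionProofs.lean), Aissen–Schoenberg–Whitney's Theorem 2
(`asw1952_representation`, the meromorphic continuation `e^{g} ∏(1+αᵢz)/∏(1-βⱼz)` of a PF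
generating function) holds unconditionally: `asw1952_representation_holds`. This file draws the
consequences used in the tree's proof of Edrei's Theorem 3 (`EdreiExponentialFactor.lean`):

* `IsPolyaFrequencySeq.zero_of_entire` — if `(aₙ)` is PF with `a₀ = 1` and `F(z) = Σ aₙ zⁿ`
  converges (absolutely) on all of `ℂ`, then every zero of `F` is real and `< 0`: by Thm. 2,
  `F · ∏(1-βⱼz) = e^{g} ∏(1+αᵢz)` near `0`, hence on `ℂ` (identity theorem), and the right side
  vanishes only at the points `-1/αᵢ` [AissenEdreiSchoenbergWhitney1951, Thm. 2 and Thm. 5 (entire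
  case); Edrei 1953, §3].
* `IsPolyaFrequencySeq.subseq_even` — the even-indexed subsequence `(a₂ₙ)` of a PF sequence is PF
  (its Toeplitz matrix is the submatrix of even rows and columns) — "As (1) is totally positive,
  the coefficients of `f*(z) = a₀ + a₂z + a₄z² + …` also form a totally positive sequence"
  [Edrei1953, §4, p. 92].
* `tsum_even_eq` — `2 Σ c₂ₙ (z²)ⁿ = F(z) + F(-z)` for an absolutely convergent series.
* `IsPolyaFrequencySeq.exists_convPow` — PF convolution powers: for every `m` a PF sequence with
  generating function `F(z)ᵐ` (closure under convolution, `IsPolyaFrequencySeq.conv`).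
* `IsPolyaFrequencySeq.re_eq_zero_of_pow_add_pow` — consequently, if `F(z)ᵐ + F(-z)ᵐ = 0` for an
  entire PF generating function `F` with `F(0) = 1` and some `m ≥ 1`, then `Re z = 0`: the even part
  of `Fᵐ` is an entire PF generating function in `z²`, so `z² ∈ (-∞, 0)`.

## References

* M. Aissen, A. Edrei, I. J. Schoenberg, A. Whitney, *On the generating functions of totally
  positive sequences*, Proc. Nat. Acad. Sci. USA 37 (1951) 303–307, Thms. 2, 5.
  [AissenEdreiSchoenbergWhitney1951]
* A. Edrei, *Proof of a conjecture of Schoenberg on the generating function of a totally positive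
  sequence*, Canad. J. Math. 5 (1953) 86–94, §§3–4. [Edrei1953]
-/

noncomputable section

open Filter Complex Metric Finset
open scoped Topology Nat

namespace Literature.Analysis.TotalPositivity

/-! ### A. Aissen–Schoenberg–Whitney's Theorem 2, unconditionally -/

/-- **DISCHARGE of `asw1952_representation`** ([AissenEdreiSchoenbergWhitney1951, Thm. 2];
Aissen–Schoenberg–Whitney 1952): the generating function of a PF sequence with `a₀ = 1` is, near
`0`, `e^{g(z)} ∏(1 + αᵢz)/∏(1 - βⱼz)` with `g` entire, `αᵢ, βⱼ ≥ 0` summable and `e^{g}` generating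
a PF sequence — `asw1952_representation_of_ando` (ASWMeromorphic.lean) fed with
`ando1987_lowerTriangular_tn_holds`. [cite: AissenEdreiSchoenbergWhitney1951, Thm. 2] -/
theorem asw1952_representation_holds : asw1952_representation :=
  asw1952_representation_of_ando ando1987_lowerTriangular_tn_holds

/-- **`aswe_edrei` granted Edrei's Theorem 3 only.** [cite: AissenEdreiSchoenbergWhitney1951, Thm. 4] -/
theorem aswe_edrei_of_edrei (h3 : edrei1952_exponential_factor) : aswe_edrei :=
  aswe_edrei_of_ando ando1987_lowerTriangular_tn_holds h3

/-! ### B. Zeros of an entire PF generating function -/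

/-- **The zeros of an entire PF generating function are real and negative.** If `(aₙ)` is a Pólya
frequency sequence with `a₀ = 1` whose generating series converges absolutely at every point of
`ℂ`, then `Σ aₙ zⁿ = 0` forces `z ∈ (-∞, 0)`. (Thm. 2 gives `F ∏(1-βⱼz) = e^{g}∏(1+αᵢz)` near `0`,
hence everywhere; at a zero `z` of `F` some factor `1 + αᵢ z` vanishes.)
[AissenEdreiSchoenbergWhitney1951, Thm. 5 (entire case); Edrei 1953, §3]
[cite: AissenEdreiSchoenbergWhitney1951, Thm. 5] -/
theorem IsPolyaFrequencySeq.zero_of_entire {a : ℕ → ℝ} (ha : IsPolyaFrequencySeq a)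
    (h0 : a 0 = 1) (hS : ∀ z : ℂ, Summable fun n => ‖(a n : ℂ) * z ^ n‖) {z : ℂ}
    (hz : ∑' n, (a n : ℂ) * z ^ n = 0) : z.im = 0 ∧ z.re < 0 := by
  obtain ⟨g, u, α, β, hg, hα, hβ, hαs, hβs, -, -, ρ, hρ, hrep⟩ :=
    asw1952_representation_holds a ha h0
  set F : ℂ → ℂ := fun z => ∑' n, (a n : ℂ) * z ^ n with hF
  have hFd : Differentiable ℂ F := differentiable_tsum_of_summable hS
  have hαc : Summable fun i => ‖((α i : ℝ) : ℂ)‖ := summable_norm_ofReal hα hαs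
  have hβc : Summable fun j => ‖((β j : ℝ) : ℂ)‖ := summable_norm_ofReal hβ hβs
  set P : ℂ → ℂ := fun z => ∏' i, (1 + (α i : ℂ) * z) with hP
  set Q : ℂ → ℂ := fun z => ∏' j, (1 - (β j : ℂ) * z) with hQ
  have hPd : Differentiable ℂ P := differentiable_tprod_one_add hαc
  have hQd : Differentiable ℂ Q := differentiable_tprod_one_sub hβc
  -- `Q ≠ 0` near `0`
  have hQ0 : Q 0 = 1 := by simp [hQ]
  obtain ⟨δ, hδ, hQne⟩ : ∃ δ > 0, ∀ z : ℂ, ‖z‖ < δ → Q z ≠ 0 := by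
    have hc : ContinuousAt Q 0 := hQd.continuous.continuousAt
    have : ∀ᶠ z in 𝓝 (0 : ℂ), Q z ≠ 0 := hc.eventually_ne (by rw [hQ0]; exact one_ne_zero)
    obtain ⟨δ, hδ, h⟩ := Metric.eventually_nhds_iff.1 this
    exact ⟨δ, hδ, fun z hz => h (by simpa using hz)⟩
  -- the identity `F Q = e^{g} P` on `ℂ`
  have hident : (fun z => F z * Q z) = fun z => Complex.exp (g z) * P z := by
    refine AnalyticOnNhd.eq_of_frequently_eq (z₀ := (0 : ℂ))
      (analyticOnNhd_univ_iff_differentiable.2 (hFd.mul hQd))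
      (analyticOnNhd_univ_iff_differentiable.2 ((hg.cexp).mul hPd)) ?_
    have hev : ∀ᶠ z : ℂ in 𝓝 0, F z * Q z = Complex.exp (g z) * P z := by
      filter_upwards [Metric.ball_mem_nhds (0 : ℂ) (lt_min hρ hδ)] with z hz
      rw [Metric.mem_ball, dist_zero_right, lt_min_iff] at hz
      have h1 : F z = Complex.exp (g z) * P z / Q z := (hrep z hz.1).tsum_eq
      rw [h1, div_mul_cancel₀ _ (hQne z hz.2)]
    exact (hev.filter_mono nhdsWithin_le_nhds).frequently
  -- at a zero of `F`, `P` vanishes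
  have hPz : P z = 0 := by
    have h1 : F z * Q z = Complex.exp (g z) * P z := congrFun hident z
    rw [show F z = 0 from hz, zero_mul] at h1
    rcases mul_eq_zero.1 h1.symm with h | h
    · exact absurd h (Complex.exp_ne_zero _)
    · exact h
  obtain ⟨i, hi⟩ := exists_factor_eq_zero_of_tprod_eq_zero hαc hPz
  have hαi : α i ≠ 0 := by
    intro h0'
    rw [h0'] at hi
    simp at hi
  have hαpos : 0 < α i := lt_of_le_of_ne (hα i) (Ne.symm hαi)
  have hz' : z = -(((α i)⁻¹ : ℝ) : ℂ) := by
    have h1 : ((α i : ℝ) : ℂ) * z = -1 := by linear_combination hi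
    have h2 : ((α i : ℝ) : ℂ) ≠ 0 := by exact_mod_cast hαi
    push_cast
    field_simp
    linear_combination h1
  rw [hz']
  constructor
  · simp
  · simp only [Complex.neg_re, Complex.ofReal_re, Left.neg_neg_iff]
    exact inv_pos.2 hαpos

/-! ### C. Even subsequences -/

/-- **The even-indexed subsequence of a PF sequence is PF**: the Toeplitz matrix of `(a₂ₙ)` is the
submatrix of `(a_{i-j})` on even rows and columns. [Edrei1953, §4 (p. 92)]
[cite: Edrei1953, §4] -/
theorem IsPolyaFrequencySeq.subseq_even {a : ℕ → ℝ} (h : IsPolyaFrequencySeq a) :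
    IsPolyaFrequencySeq fun n => a (2 * n) := by
  intro m r c hr hc
  have hmin : toeplitzMinor (fun n => a (2 * n)) r c =
      toeplitzMinor a (fun i => 2 * r i) (fun j => 2 * c j) := by
    unfold toeplitzMinor
    congr 1
    ext i j
    simp only [Matrix.of_apply, seqZ]
    push_cast
    by_cases hij : c j ≤ r i
    · have h1 : (0 : ℤ) ≤ (r i : ℤ) - c j := by omega
      have h2 : (0 : ℤ) ≤ 2 * (r i : ℤ) - 2 * c j := by omega
      rw [if_pos h1, if_pos h2]
      congr 1
      omega
    · have h1 : ¬ (0 : ℤ) ≤ (r i : ℤ) - c j := by omega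
      have h2 : ¬ (0 : ℤ) ≤ 2 * (r i : ℤ) - 2 * c j := by omega
      rw [if_neg h1, if_neg h2]
  rw [hmin]
  exact h m (fun i => 2 * r i) (fun j => 2 * c j)
    (fun i j hij => by show 2 * r i < 2 * r j; have := hr hij; omega)
    (fun i j hij => by show 2 * c i < 2 * c j; have := hc hij; omega)

/-- **Even part of an absolutely convergent power series**: `2 Σ c₂ₙ (z²)ⁿ = F(z) + F(-z)`.
[folklore] -/
theorem tsum_even_eq {c : ℕ → ℂ} {z : ℂ} (hS : Summable fun n => ‖c n * z ^ n‖) :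
    2 * ∑' n, c (2 * n) * (z ^ 2) ^ n = (∑' n, c n * z ^ n) + ∑' n, c n * (-z) ^ n := by
  set f : ℕ → ℂ := fun n => c n * z ^ n with hf
  set f' : ℕ → ℂ := fun n => c n * (-z) ^ n with hf'
  have hs : Summable f := hS.of_norm
  have hs' : Summable f' := by
    refine (hS.congr fun n => ?_).of_norm
    simp [hf', norm_pow]
  have hinj1 : Function.Injective fun k : ℕ => 2 * k := mul_right_injective₀ two_ne_zero
  have hinj2 : Function.Injective fun k : ℕ => 2 * k + 1 := fun a b hab => by
    simpa using hab
  have he := tsum_even_add_odd (hs.comp_injective hinj1) (hs.comp_injective hinj2)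
  have he' := tsum_even_add_odd (hs'.comp_injective hinj1) (hs'.comp_injective hinj2)
  have h1 : ∀ k : ℕ, f' (2 * k) = f (2 * k) := fun k => by
    simp only [hf, hf']
    rw [neg_pow, pow_mul, neg_one_sq, one_pow, one_mul]
  have h2 : ∀ k : ℕ, f' (2 * k + 1) = -f (2 * k + 1) := fun k => by
    simp only [hf, hf']
    rw [neg_pow, pow_succ, pow_mul, neg_one_sq, one_pow, one_mul]
    ring
  simp only [h1, h2, tsum_neg] at he'
  have h3 : ∀ k : ℕ, c (2 * k) * (z ^ 2) ^ k = f (2 * k) := fun k => by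
    simp only [hf]
    rw [← pow_mul]
  simp only [h3]
  change 2 * ∑' n, f (2 * n) = (∑' n, f n) + ∑' n, f' n
  linear_combination he + he'

/-- Absolute convergence of the even part at every point (every complex number is a square).
[folklore] -/
theorem summable_norm_even {c : ℕ → ℂ} (hS : ∀ z : ℂ, Summable fun n => ‖c n * z ^ n‖) (ζ : ℂ) :
    Summable fun n => ‖c (2 * n) * ζ ^ n‖ := by
  obtain ⟨s, hs⟩ := IsAlgClosed.exists_pow_nat_eq ζ two_pos
  have := (hS s).comp_injective (mul_right_injective₀ (two_ne_zero (α := ℕ)))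
  refine this.congr fun n => ?_
  simp [← hs, pow_mul]

/-! ### D. Convolution powers -/

/-- `(a ⋆ b)₀ = a₀ b₀`. [folklore] -/
theorem conv_apply_zero (a b : ℕ → ℝ) : conv a b 0 = a 0 * b 0 := by
  simp [conv]

/-- **PF convolution powers.** If `(wₙ)` is PF with `w₀ = 1` and `W(z) = Σ wₙ zⁿ` converges
absolutely on `ℂ`, then for every `m` there is a PF sequence `(pₙ)` with `p₀ = 1` whose generating
series converges absolutely on `ℂ` to `W(z)ᵐ` — the `m`-fold convolution power ("the product of
two totally positive [generating] functions is totally positive",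
[AissenEdreiSchoenbergWhitney1951, p. 304]). [cite: AissenEdreiSchoenbergWhitney1951, Thm. 1] -/
theorem IsPolyaFrequencySeq.exists_convPow {w : ℕ → ℝ} (hw : IsPolyaFrequencySeq w)
    (hw0 : w 0 = 1) (hS : ∀ z : ℂ, Summable fun n => ‖(w n : ℂ) * z ^ n‖) (m : ℕ) :
    ∃ p : ℕ → ℝ, IsPolyaFrequencySeq p ∧ p 0 = 1 ∧
      (∀ z : ℂ, Summable fun n => ‖(p n : ℂ) * z ^ n‖) ∧
      ∀ z : ℂ, HasSum (fun n => (p n : ℂ) * z ^ n) ((∑' n, (w n : ℂ) * z ^ n) ^ m) := by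
  induction m with
  | zero =>
    refine ⟨fun k => if k = 0 then 1 else 0, isPolyaFrequencySeq_delta, by simp, fun z => ?_,
      fun z => ?_⟩
    · refine summable_of_ne_finset_zero (s := {0}) fun n hn => ?_
      rw [Finset.mem_singleton] at hn
      simp [hn]
    · rw [pow_zero]
      have := hasSum_single (f := fun n : ℕ => (((if n = 0 then (1 : ℝ) else 0) : ℝ) : ℂ) * z ^ n)
        0 (fun n hn => by simp [hn])
      simpa using this
  | succ m ih =>
    obtain ⟨p, hp, hp0, hSp, hsum⟩ := ih
    have hws : ∀ z : ℂ, HasSum (fun n => (w n : ℂ) * z ^ n) (∑' n, (w n : ℂ) * z ^ n) :=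
      fun z => (hS z).of_norm.hasSum
    have hsum' : ∀ z : ℂ, HasSum (fun n => (TotalPositivity.conv p w n : ℂ) * z ^ n)
        ((∑' n, (w n : ℂ) * z ^ n) ^ (m + 1)) := fun z => by
      rw [pow_succ]
      exact hasSum_conv (hsum z) (hws z) (hSp z) (hS z)
    refine ⟨TotalPositivity.conv p w, hp.conv hw, by rw [conv_apply_zero, hp0, hw0, mul_one],
      fun z => ?_, hsum'⟩
    exact summable_norm_of_hasSum (r := ‖z‖ + 1) (by positivity) (fun z' _ => hsum' z')
      (lt_add_one _)

/-! ### E. `F(z)ᵐ + F(-z)ᵐ = 0` forces `Re z = 0` -/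

/-- **The even part of `Fᵐ` has its zeros on the imaginary axis.** Let `(wₙ)` be PF with
`w₀ = 1` and `W(z) = Σ wₙ zⁿ` absolutely convergent on `ℂ`. If `W(z)ᵐ + W(-z)ᵐ = 0` then
`Re z = 0`: the even-indexed subsequence of the `m`-th convolution power is a PF sequence whose
(entire) generating function `E` satisfies `2E(z²) = W(z)ᵐ + W(-z)ᵐ`, so `z²` is a zero of `E`,
i.e. real and negative (`IsPolyaFrequencySeq.zero_of_entire`). This is the tree's form of Edrei's
use of `f*(z) = a₀ + a₂z + …` [Edrei1953, §4, (23)–(27)]. [cite: Edrei1953, §4] -/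
theorem IsPolyaFrequencySeq.re_eq_zero_of_pow_add_pow {w : ℕ → ℝ} (hw : IsPolyaFrequencySeq w)
    (hw0 : w 0 = 1) (hS : ∀ z : ℂ, Summable fun n => ‖(w n : ℂ) * z ^ n‖) (m : ℕ) {z : ℂ}
    (hz : (∑' n, (w n : ℂ) * z ^ n) ^ m + (∑' n, (w n : ℂ) * (-z) ^ n) ^ m = 0) : z.re = 0 := by
  obtain ⟨p, hp, hp0, hSp, hsum⟩ := hw.exists_convPow hw0 hS m
  -- the even subsequence `e` of `p` and its entire generating function
  set e : ℕ → ℝ := fun n => p (2 * n) with he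
  have hePF : IsPolyaFrequencySeq e := hp.subseq_even
  have he0 : e 0 = 1 := by simp [he, hp0]
  have hSe : ∀ ζ : ℂ, Summable fun n => ‖(e n : ℂ) * ζ ^ n‖ := fun ζ => by
    have := summable_norm_even (c := fun n => (p n : ℂ)) hSp ζ
    simpa [he] using this
  -- `2 E(z²) = W(z)ᵐ + W(-z)ᵐ = 0`
  have hE : ∑' n, (e n : ℂ) * (z ^ 2) ^ n = 0 := by
    have h2 := tsum_even_eq (c := fun n => (p n : ℂ)) (hSp z)
    rw [(hsum z).tsum_eq, (hsum (-z)).tsum_eq, hz] at h2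
    have : (2 : ℂ) ≠ 0 := two_ne_zero
    simpa [he] using (mul_eq_zero.1 h2).resolve_left this
  obtain ⟨him, hre⟩ := hePF.zero_of_entire he0 hSe hE
  -- `z² ∈ (-∞, 0)` forces `Re z = 0`
  have him' : 2 * z.re * z.im = 0 := by
    have : (z ^ 2).im = 2 * z.re * z.im := by simp [pow_two]; ring
    rw [← this, him]
  have hre' : z.re * z.re - z.im * z.im < 0 := by
    have : (z ^ 2).re = z.re * z.re - z.im * z.im := by simp [pow_two]
    rw [← this]; exact hre
  by_contra hx
  have hy : z.im = 0 := by
    rcases mul_eq_zero.1 him' with h | h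
    · rcases mul_eq_zero.1 h with h | h
      · norm_num at h
      · exact absurd h hx
    · exact h
  rw [hy, mul_zero, sub_zero] at hre'
  nlinarith [mul_self_nonneg z.re]

end Literature.Analysis.TotalPositivity
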